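import Literature.Computability.Cryptography.LWEModulusSwitchSamples
import Literature.Computability.Cryptography.ExtLWE
import Literature.Algebra.EuclideanLattices.DiscreteGaussianInt
import Literature.Probability.Distributions.IndepProductLawMeasure
import HarnessLib

/-!
# BLPRS 2013, §4.3 (Lemma 4.9, reducing to binary secret): the hybrid laws in the torus model

Topic `Computability/Cryptography` (LWE), grouping namespace `BLPRS2013` (the model of
`LWEModulusSwitchSamples.lean`: transcripts `Fin m → ℤ_qⁿ × 𝕋`, `uniformInputs`, `lweInputsMix`). Proved
material (no named fact) towards
`Literature.Computability.Cryptography.blprs_gapSVP_sqrt_dim_to_lwe_classical` (**pqc.S21**;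
Brakerski–Langlois–Peikert–Regev–Stehlé, STOC 2013), hypothesis `h₃` of `BLPRSReduction.lean`: the
third step of the binary-secret Theorem 4.1.

> **Lemma 4.9.** Let `k,n,m,q ∈ ℕ`, `ε ∈ (0,1/2)`, `δ, α, β, γ > 0` with `n ≥ k log₂ q + 2 log₂(1/δ)`,
> `β ≥ √(2 ln(2n(1+1/ε))/π)/q`, `α = √(2n) β`, `γ = √n β`. Then there are three (transformation)
> reductions to `binLWE_{n,m,q,≤α}` from `extLWE^m_{k,n,q,β,{0,1}ⁿ}`, `LWE_{k,m,q,γ}` and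
> `extLWE^m_{k,n,q,β,{0ⁿ}}`, with algorithms `ℬ₁, ℬ₂, ℬ₃` obtained from `𝒜`, such that
> `Adv[𝒜] ≤ Adv[ℬ₁] + Adv[ℬ₂] + Adv[ℬ₃] + 4mε + δ`.
> *Proof* by the hybrids `H₀ = (A, Aᵀz + e)`, `H₁ = (A, Aᵀz - Nᵀz + h)`,
> `H₂ = (Â := qCᵀB + N, qBᵀCz + h)`, `H₃ = (Â, Bᵀs + h)`, `H₄ = (Â, u)`, `H₅ = (A, u)`.

This first file fixes the HYBRID LAWS `H₀, …, H₅` as measures on transcripts, in integer coordinates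
(`ā_j ∈ ℤ_qⁿ`, the noise matrix `N̄ = qN ∈ ℤ^{n×m}` with iid `D_{ℤ,βq}` entries, `h ← D_γ^m` continuous,
`z ← U{0,1}ⁿ`, `C̄ ← U(ℤ_q^{k×n})`, `b̄_j ← U(ℤ_q^k)`, `s ← U(ℤ_q^k)`, `u ← Haar`): each hybrid is a
mixture over its shared data of a PRODUCT over the `m` positions of an explicit one-position law
(`h1Coord, …, h4Coord`), the shape of `lweInputsMix`/`piKernel`; `H₀ = lweInputsMix (uniformBinary) (binRate β γ)`
(`binLWE_{n,m,q,≤α}` with the rate `√(β²‖z‖² + γ²) ≤ α` of the proof, `binRate_le`) and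
`H₅ = uniformInputs`; the elementary accounting `hybrid_triangle`; and the EXACT identification of
`(H₃, H₄)` as the output laws of `ℬ₂` on `LWE_{k,m,q,γ}` (`b2Kernel`, `b2Outputs`,
**`b2Outputs_lweInputsUnif`**, **`b2Outputs_uniformInputs`**) and of `(H₄, H₅)` as the output laws of `ℬ₃`
on `extLWE^m_{k,n,q,D_{ℤ,βq}^{⊗n},·}` in the tree's discrete `extLWE` model (`ExtLWE.lean`: `extLWEReal`,
`extLWEIdeal` over `R = ℤ_q`; `b3Kernel`, `b3Outputs`, **`b3Outputs_extLWEReal`**, **`b3Outputs_extLWEIdeal`**).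
The identification of `(H₁, H₂)` as `ℬ₁`'s outputs (with the hints `⟨N̄_{·j}, z⟩`) and the two analytic
steps (`H₀ ≈_{4mε} H₁` by Regev's Cor. 3.10, `H₂ ≈_δ H₃` by the leftover hash lemma) are the sequel's.

## References

* Z. Brakerski, A. Langlois, C. Peikert, O. Regev, D. Stehlé, *Classical hardness of learning with
  errors*, STOC 2013; arXiv:1306.0281, §4.3, Lemma 4.9 and its proof. [BrakerskiEtAl2013]
-/

noncomputable section

open MeasureTheory ProbabilityTheory Module Matrix Literature.Algebra.EuclideanLattices Literature.Probability.Distributions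
open scoped Real ENNReal NNReal

namespace Literature.Computability.Cryptography

namespace BLPRS2013

/-! ### Binary secrets and the rate of the binary-secret problem -/

section Binary

variable (n : ℕ)

/-- A binary vector as an integer vector. [folklore] -/
def binInt (z : Fin n → Bool) : Fin n → ℤ := fun i => if z i then 1 else 0

/-- **The uniform binary secret** `z ← U{0,1}ⁿ` (as a distribution over `ℤⁿ`). [cite: BrakerskiEtAl2013, §4.3 (binLWE)] -/
def uniformBinary : PMF (Fin n → ℤ) := (PMF.uniformOfFintype (Fin n → Bool)).map (binInt n)

/-- **The rate of the hybrid `H₀`**: `α'(z) = √(β²‖z‖² + γ²)` (`≤ √(2n)β = α` for `γ = √n β`).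
[cite: BrakerskiEtAl2013, Lemma 4.9 (proof, first paragraph)] -/
def binRate (β γ : ℝ) (z : Fin n → ℤ) : ℝ := Real.sqrt (β ^ 2 * ‖intVecToEuclidean n z‖ ^ 2 + γ ^ 2)

/-- The rate is positive for `γ > 0`. [folklore] -/
theorem binRate_pos {β γ : ℝ} (hγ : 0 < γ) (z : Fin n → ℤ) : 0 < binRate n β γ z :=
  Real.sqrt_pos.2 (by positivity)

/-- `‖z‖² ≤ n` for a binary `z`. [folklore] -/
theorem norm_sq_binInt_le (z : Fin n → Bool) : ‖intVecToEuclidean n (binInt n z)‖ ^ 2 ≤ n := by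
  rw [EuclideanSpace.norm_eq, Real.sq_sqrt (Finset.sum_nonneg fun i _ => sq_nonneg _)]
  calc ∑ i, ‖intVecToEuclidean n (binInt n z) i‖ ^ 2 ≤ ∑ _i : Fin n, (1 : ℝ) := Finset.sum_le_sum fun i _ => by
        have : intVecToEuclidean n (binInt n z) i = ((binInt n z i : ℤ) : ℝ) := rfl
        rw [this, Real.norm_eq_abs, sq_abs, binInt]
        split_ifs <;> simp
    _ = n := by simp

/-- **The rate is at most `α = √(2n)β`** for `γ = √n β` and a binary secret. [cite: BrakerskiEtAl2013, Lemma 4.9 (proof)] -/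
theorem binRate_le {β : ℝ} (hβ : 0 ≤ β) (z : Fin n → Bool) :
    binRate n β (Real.sqrt n * β) (binInt n z) ≤ Real.sqrt (2 * n) * β := by
  unfold binRate
  rw [show Real.sqrt (2 * n) * β = Real.sqrt (2 * n * β ^ 2) by
    rw [Real.sqrt_mul (by positivity : (0 : ℝ) ≤ 2 * n) (β ^ 2), Real.sqrt_sq hβ]]
  apply Real.sqrt_le_sqrt
  have h1 := norm_sq_binInt_le n z
  have h2 : (Real.sqrt n * β) ^ 2 = n * β ^ 2 := by rw [mul_pow, Real.sq_sqrt (Nat.cast_nonneg n)]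
  rw [h2]
  nlinarith [sq_nonneg β]

end Binary

/-! ### The one-position laws of the hybrids -/

section Coords

variable (k n q : ℕ) [NeZero q]

/-- The continuous Gaussian `D_γ` on `ℝ` (`N(0, γ²/(2π))`). [cite: RegevLWE2009, §2] -/
abbrev gaussR (γ : ℝ) : Measure ℝ := gaussianReal 0 (Real.toNNReal (γ ^ 2 / (2 * Real.pi)))

/-- The integer noise column `N̄_{·j} ← D_{ℤ,t}^{⊗n}` (`t = βq`: `N̄ = qN`, `N ← D_{q⁻¹ℤ,β}`). [cite: BrakerskiEtAl2013, Lemma 4.9 (proof, `N ← D_{q⁻¹ℤ,β}^{n×m}`)] -/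
def noiseCol (t : ℝ) : PMF (Fin n → ℤ) := LWE.iidPMF (discreteGaussianInt t 0) n

/-- The integer pairing `⟨N̄_{·j}, z⟩`. [folklore] -/
def ipair (x z : Fin n → ℤ) : ℤ := ∑ i, x i * z i

/-- **One position of `H₁`** given the binary secret `z`: `(ā, (⟨ā, z⟩ - ⟨N̄, z⟩)/q + h)` with `ā ← U(ℤ_qⁿ)`,
`N̄ ← D_{ℤ,βq}^{⊗n}`, `h ← D_γ`. [cite: BrakerskiEtAl2013, Lemma 4.9 (proof, `H₁`)] -/
def h1Coord (t γ : ℝ) (z : Fin n → ℤ) : Measure ((Fin n → ZMod q) × UnitAddCircle) :=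
  (((PMF.uniformOfFintype (Fin n → ZMod q)).toMeasure.prod ((noiseCol n t).toMeasure.prod (gaussR γ)))).map
    fun p => (p.1, ((((p.1 ⬝ᵥ fun i => (z i : ZMod q)).val : ℝ) / q - ((ipair n p.2.1 z : ℤ) : ℝ) / q + p.2.2 : ℝ) : UnitAddCircle))

/-- **One position of `H₂`** given `z` and `C̄`: `(C̄ᵀb̄ + N̄, ⟨b̄, C̄z⟩/q + h)` with `b̄ ← U(ℤ_q^k)`.
[cite: BrakerskiEtAl2013, Lemma 4.9 (proof, `H₂`, `Â = qCᵀB + N`)] -/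
def h2Coord (t γ : ℝ) (z : Fin n → ℤ) (C : Matrix (Fin k) (Fin n) (ZMod q)) : Measure ((Fin n → ZMod q) × UnitAddCircle) :=
  (((PMF.uniformOfFintype (Fin k → ZMod q)).toMeasure.prod ((noiseCol n t).toMeasure.prod (gaussR γ)))).map
    fun p => (Cᵀ.mulVec p.1 + fun i => (p.2.1 i : ZMod q),
      ((((p.1 ⬝ᵥ C.mulVec fun i => (z i : ZMod q)).val : ℝ) / q + p.2.2 : ℝ) : UnitAddCircle))

/-- **One position of `H₃`** given `s` and `C̄`: `(C̄ᵀb̄ + N̄, ⟨b̄, s⟩/q + h)`. [cite: BrakerskiEtAl2013, Lemma 4.9 (proof, `H₃`)] -/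
def h3Coord (t γ : ℝ) (s : Fin k → ZMod q) (C : Matrix (Fin k) (Fin n) (ZMod q)) : Measure ((Fin n → ZMod q) × UnitAddCircle) :=
  (((PMF.uniformOfFintype (Fin k → ZMod q)).toMeasure.prod ((noiseCol n t).toMeasure.prod (gaussR γ)))).map
    fun p => (Cᵀ.mulVec p.1 + fun i => (p.2.1 i : ZMod q), ((((p.1 ⬝ᵥ s).val : ℝ) / q + p.2.2 : ℝ) : UnitAddCircle))

/-- **One position of `H₄`** given `C̄`: `(C̄ᵀb̄ + N̄, u)` with `u ← Haar`. [cite: BrakerskiEtAl2013, Lemma 4.9 (proof, `H₄`)] -/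
def h4Coord (t : ℝ) (C : Matrix (Fin k) (Fin n) (ZMod q)) : Measure ((Fin n → ZMod q) × UnitAddCircle) :=
  (((PMF.uniformOfFintype (Fin k → ZMod q)).toMeasure.prod ((noiseCol n t).toMeasure.prod (volume : Measure UnitAddCircle)))).map
    fun p => (Cᵀ.mulVec p.1 + fun i => (p.2.1 i : ZMod q), p.2.2)

end Coords

/-! ### The hybrids -/

section Hybrids

variable (k n q : ℕ) [NeZero q] (m : ℕ)

/-- **`H₀ = binLWE_{n,m,q}`** with the binary secret and the rate `√(β²‖z‖² + γ²)`. [cite: BrakerskiEtAl2013, Lemma 4.9 (proof, `H₀`)] -/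
def H0 (β γ : ℝ) : Measure (Fin m → (Fin n → ZMod q) × UnitAddCircle) := lweInputsMix n q m (uniformBinary n) (binRate n β γ)

/-- **`H₁`**: mixture over `z` of the product of `h1Coord`. [cite: BrakerskiEtAl2013, Lemma 4.9 (proof, `H₁`)] -/
def H1 (t γ : ℝ) : Measure (Fin m → (Fin n → ZMod q) × UnitAddCircle) :=
  Measure.sum fun z : Fin n → Bool => (PMF.uniformOfFintype (Fin n → Bool) z) • Measure.pi fun _ : Fin m => h1Coord n q t γ (binInt n z)

/-- **`H₂`**: mixture over `z` then `C̄` of the product of `h2Coord`. [cite: BrakerskiEtAl2013, Lemma 4.9 (proof, `H₂`)] -/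
def H2 (t γ : ℝ) : Measure (Fin m → (Fin n → ZMod q) × UnitAddCircle) :=
  Measure.sum fun z : Fin n → Bool => (PMF.uniformOfFintype _ z) •
    Measure.sum fun C : Matrix (Fin k) (Fin n) (ZMod q) => (PMF.uniformOfFintype _ C) • Measure.pi fun _ : Fin m => h2Coord k n q t γ (binInt n z) C

/-- **`H₃`**: mixture over `C̄` then `s` of the product of `h3Coord`. [cite: BrakerskiEtAl2013, Lemma 4.9 (proof, `H₃`)] -/
def H3 (t γ : ℝ) : Measure (Fin m → (Fin n → ZMod q) × UnitAddCircle) :=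
  Measure.sum fun C : Matrix (Fin k) (Fin n) (ZMod q) => (PMF.uniformOfFintype _ C) •
    Measure.sum fun s : Fin k → ZMod q => (PMF.uniformOfFintype _ s) • Measure.pi fun _ : Fin m => h3Coord k n q t γ s C

/-- **`H₄`**: mixture over `C̄` of the product of `h4Coord`. [cite: BrakerskiEtAl2013, Lemma 4.9 (proof, `H₄`)] -/
def H4 (t : ℝ) : Measure (Fin m → (Fin n → ZMod q) × UnitAddCircle) :=
  Measure.sum fun C : Matrix (Fin k) (Fin n) (ZMod q) => (PMF.uniformOfFintype _ C) • Measure.pi fun _ : Fin m => h4Coord k n q t C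

/-- **`H₅ = P₀`**: independent uniform samples. [cite: BrakerskiEtAl2013, Lemma 4.9 (proof, `H₅`)] -/
def H5 : Measure (Fin m → (Fin n → ZMod q) × UnitAddCircle) := uniformInputs n q m

/-- **The accounting of Lemma 4.9**: for every event, `|H₀ - H₅| ≤ |H₁ - H₂| + |H₃ - H₄| + |H₄ - H₅| + |H₀ - H₁| + |H₂ - H₃|`
(the first three are the advantages of `ℬ₁, ℬ₂, ℬ₃`, the last two are `≤ 4mε` and `≤ δ`).
[cite: BrakerskiEtAl2013, Lemma 4.9 (proof, "Putting together Eq. (h0)–(h4)")] -/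
theorem hybrid_triangle (x₀ x₁ x₂ x₃ x₄ x₅ : ℝ) :
    |x₀ - x₅| ≤ |x₁ - x₂| + |x₃ - x₄| + |x₄ - x₅| + |x₀ - x₁| + |x₂ - x₃| := by
  have h := abs_sub_le x₀ x₁ x₅
  have h' := abs_sub_le x₁ x₂ x₅
  have h'' := abs_sub_le x₂ x₃ x₅
  have h''' := abs_sub_le x₃ x₄ x₅
  linarith

end Hybrids

/-! ### The transformation `ℬ₂`: a kernel per position, after the shared uniform `C̄` -/

section B2

variable (k n q : ℕ) [NeZero q]

/-- **The position kernel of `ℬ₂` at a fixed `C̄`**: `(b̄, v) ↦ (C̄ᵀb̄ + N̄, v)` with a fresh noise column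
`N̄ ← D_{ℤ,t}^{⊗n}` (a countable mixture of point masses). [cite: BrakerskiEtAl2013, Lemma 4.9 (proof, "`H₃, H₄` can be computed efficiently from `(B, Bᵀs + h), (B, u)`")] -/
def b2Kernel (t : ℝ) (C : Matrix (Fin k) (Fin n) (ZMod q)) (x : (Fin k → ZMod q) × UnitAddCircle) :
    Measure ((Fin n → ZMod q) × UnitAddCircle) :=
  Measure.sum fun N : Fin n → ℤ => (noiseCol n t N) • Measure.dirac (Cᵀ.mulVec x.1 + fun i => (N i : ZMod q), x.2)

variable {k n q}

omit [NeZero q] in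
/-- The position kernel on a measurable set. [folklore] -/
theorem b2Kernel_apply (t : ℝ) (C : Matrix (Fin k) (Fin n) (ZMod q)) (x : (Fin k → ZMod q) × UnitAddCircle)
    {S : Set ((Fin n → ZMod q) × UnitAddCircle)} (hS : MeasurableSet S) :
    b2Kernel k n q t C x S = ∑' N : Fin n → ℤ, noiseCol n t N * S.indicator 1 (Cᵀ.mulVec x.1 + fun i => (N i : ZMod q), x.2) := by
  rw [b2Kernel, Measure.sum_apply _ hS]
  refine tsum_congr fun N => ?_
  rw [Measure.smul_apply, smul_eq_mul, Measure.dirac_apply' _ hS]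

/-- The position kernel is Markov. [folklore] -/
instance isProbabilityMeasure_b2Kernel (t : ℝ) (C : Matrix (Fin k) (Fin n) (ZMod q)) (x : (Fin k → ZMod q) × UnitAddCircle) :
    IsProbabilityMeasure (b2Kernel k n q t C x) := by
  constructor
  rw [b2Kernel_apply t C x MeasurableSet.univ]
  simp [PMF.tsum_coe]

/-- **The position kernel is measurable** (countable first factor; in the second factor each summand is the
indicator of a measurable section). [folklore] -/
theorem measurable_b2Kernel (t : ℝ) (C : Matrix (Fin k) (Fin n) (ZMod q)) : Measurable (b2Kernel k n q t C) := by
  refine Measure.measurable_of_measurable_coe _ fun S hS => ?_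
  have h : (fun x => b2Kernel k n q t C x S) = fun x => ∑' N : Fin n → ℤ,
      noiseCol n t N * S.indicator 1 (Cᵀ.mulVec x.1 + fun i => (N i : ZMod q), x.2) := funext fun x => b2Kernel_apply t C x hS
  rw [h]
  refine measurable_from_prod_countable_right fun b => ?_
  dsimp only
  refine Measurable.tsum fun N => ?_
  refine Measurable.const_mul ?_ _
  exact (measurable_one.indicator hS).comp (measurable_const.prodMk measurable_id)

/-- **The outputs of `ℬ₂`**: draw `C̄` uniformly, then apply the position kernel to every sample.
[cite: BrakerskiEtAl2013, Lemma 4.9 (proof, `ℬ₂`)] -/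
def b2Outputs (m : ℕ) (t : ℝ) (μ : Measure (Fin m → (Fin k → ZMod q) × UnitAddCircle)) : Measure (Fin m → (Fin n → ZMod q) × UnitAddCircle) :=
  Measure.sum fun C : Matrix (Fin k) (Fin n) (ZMod q) => (PMF.uniformOfFintype _ C) • μ.bind (piKernel (b2Kernel k n q t C) m)

/-- **`ℬ₂` on uniform samples gives `H₄`** (position-wise: `(uniformInput k q).bind (b2Kernel C) = h4Coord C`).
[cite: BrakerskiEtAl2013, Lemma 4.9 (proof, Eq. (h3))] -/
theorem uniformInput_bind_b2Kernel (t : ℝ) (C : Matrix (Fin k) (Fin n) (ZMod q)) :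
    (uniformInput k q).bind (b2Kernel k n q t C) = h4Coord k n q t C := by
  -- the map of `h4Coord` is measurable
  have hF : Measurable fun p : (Fin k → ZMod q) × ((Fin n → ℤ) × UnitAddCircle) => (Cᵀ.mulVec p.1 + fun i => (p.2.1 i : ZMod q), p.2.2) :=
    measurable_from_prod_countable_right fun b => measurable_from_prod_countable_right fun N => by
      dsimp only; exact measurable_const.prodMk measurable_id
  ext S hS
  have hmeas : Measurable fun x => b2Kernel k n q t C x S := (Measure.measurable_coe hS).comp (measurable_b2Kernel t C)
  rw [Measure.bind_apply hS (measurable_b2Kernel t C).aemeasurable, uniformInput, lintegral_prod _ hmeas.aemeasurable, lintegral_fintype,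
    h4Coord, Measure.map_apply hF hS, Measure.prod_apply (hF hS), lintegral_fintype]
  refine Finset.sum_congr rfl fun b _ => ?_
  rw [PMF.toMeasure_apply_singleton _ _ (measurableSet_singleton _)]
  congr 1
  -- the inner integral over `(N̄, u)`: both are `∑_N D(N) · vol{u | (C̄ᵀb + N̄, u) ∈ S}`
  have hsec : ∀ N : Fin n → ℤ, Measurable fun y : UnitAddCircle =>
      S.indicator (1 : (Fin n → ZMod q) × UnitAddCircle → ℝ≥0∞) (Cᵀ.mulVec b + fun i => (N i : ZMod q), y) :=
    fun N => (measurable_one.indicator hS).comp (measurable_const.prodMk measurable_id)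
  rw [Measure.prod_apply (measurable_prodMk_left (hF hS))]
  conv_rhs => rw [lintegral_countable']
  simp_rw [b2Kernel_apply t C _ hS]
  rw [lintegral_tsum fun N => ((hsec N).const_mul _).aemeasurable]
  refine tsum_congr fun N => ?_
  rw [lintegral_const_mul _ (hsec N), PMF.toMeasure_apply_singleton _ _ (measurableSet_singleton _), mul_comm (noiseCol n t N)]
  congr 1
  rw [← lintegral_indicator_one (measurable_prodMk_left (measurable_prodMk_left (hF hS)))]
  rfl

/-- **`ℬ₂` on `m` independent uniform samples gives `H₄`.** [cite: BrakerskiEtAl2013, Lemma 4.9 (proof, Eq. (h3))] -/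
theorem b2Outputs_uniformInputs (m : ℕ) (t : ℝ) : b2Outputs (n := n) m t (uniformInputs k q m) = H4 k n q m t := by
  rw [b2Outputs, H4]
  congr 1
  funext C
  rw [uniformInputs, pi_bind_piKernel (measurable_b2Kernel t C)]
  simp_rw [uniformInput_bind_b2Kernel t C]

/-- **The source problem of `ℬ₂`, `LWE_{k,m,q,γ}` with a uniform secret**: mixture over `s ← U(ℤ_q^k)` of
`m` independent samples of `A_{q,s,D_γ}`. [cite: BrakerskiEtAl2013, Def. 2.11] -/
def lweInputsUnif (k q : ℕ) [NeZero q] (m : ℕ) (γ : ℝ) : Measure (Fin m → (Fin k → ZMod q) × UnitAddCircle) :=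
  Measure.sum fun s : Fin k → ZMod q => (PMF.uniformOfFintype _ s) • Measure.pi fun _ : Fin m => LWE.torusLWESample q (LWE.wrappedGaussian γ) s

/-- **`ℬ₂` on a sample of `A_{q,s,D_γ}` gives one position of `H₃`.** [cite: BrakerskiEtAl2013, Lemma 4.9 (proof, Eq. (h3))] -/
theorem torusLWESample_bind_b2Kernel (t γ : ℝ) (s : Fin k → ZMod q) (C : Matrix (Fin k) (Fin n) (ZMod q)) :
    (LWE.torusLWESample q (LWE.wrappedGaussian γ) s).bind (b2Kernel k n q t C) = h3Coord k n q t γ s C := by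
  have hF : Measurable fun p : (Fin k → ZMod q) × ((Fin n → ℤ) × ℝ) =>
      (Cᵀ.mulVec p.1 + fun i => (p.2.1 i : ZMod q), ((((p.1 ⬝ᵥ s).val : ℝ) / q + p.2.2 : ℝ) : UnitAddCircle)) :=
    measurable_from_prod_countable_right fun b => measurable_from_prod_countable_right fun N => by
      dsimp only; exact measurable_const.prodMk (LWE.measurable_coe_unitAddCircle.comp (measurable_const.add measurable_id))
  ext S hS
  have hmeas : Measurable fun x => b2Kernel k n q t C x S := (Measure.measurable_coe hS).comp (measurable_b2Kernel t C)
  have hmeas' : Measurable fun a => b2Kernel k n q t C (LWE.torusSampleMap q s a) S := hmeas.comp (LWE.measurable_torusSampleMap q s)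
  rw [Measure.bind_apply hS (measurable_b2Kernel t C).aemeasurable, LWE.torusLWESample,
    lintegral_map hmeas (LWE.measurable_torusSampleMap q s), lintegral_prod _ hmeas'.aemeasurable,
    lintegral_fintype, h3Coord, Measure.map_apply hF hS, Measure.prod_apply (hF hS), lintegral_fintype]
  refine Finset.sum_congr rfl fun b _ => ?_
  rw [PMF.toMeasure_apply_singleton _ _ (measurableSet_singleton _)]
  congr 1
  have hsec : ∀ (N : Fin n → ℤ), Measurable fun v : UnitAddCircle =>
      S.indicator (1 : (Fin n → ZMod q) × UnitAddCircle → ℝ≥0∞) (Cᵀ.mulVec b + fun i => (N i : ZMod q), v) :=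
    fun N => (measurable_one.indicator hS).comp (measurable_const.prodMk measurable_id)
  rw [Measure.prod_apply (measurable_prodMk_left (hF hS))]
  conv_rhs => rw [lintegral_countable']
  have hmeas'' : Measurable fun y : UnitAddCircle => b2Kernel k n q t C (LWE.torusSampleMap q s (b, y)) S := hmeas'.comp measurable_prodMk_left
  rw [LWE.wrappedGaussian, lintegral_map hmeas'' LWE.measurable_coe_unitAddCircle]
  simp only [LWE.torusSampleMap]
  simp_rw [b2Kernel_apply t C _ hS]
  have hsec' : ∀ N : Fin n → ℤ, Measurable fun a : ℝ => S.indicator (1 : (Fin n → ZMod q) × UnitAddCircle → ℝ≥0∞)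
      (Cᵀ.mulVec b + fun i => (N i : ZMod q), ((((b ⬝ᵥ s).val : ℝ) / q : ℝ) : UnitAddCircle) + (a : UnitAddCircle)) :=
    fun N => (hsec N).comp (LWE.measurable_coe_unitAddCircle.const_add _)
  rw [lintegral_tsum fun N => ((hsec' N).const_mul _).aemeasurable]
  refine tsum_congr fun N => ?_
  rw [lintegral_const_mul _ (hsec' N), PMF.toMeasure_apply_singleton _ _ (measurableSet_singleton _), mul_comm (noiseCol n t N)]
  congr 1
  rw [← lintegral_indicator_one (measurable_prodMk_left (measurable_prodMk_left (hF hS)))]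
  refine lintegral_congr fun e => ?_
  simp only [Set.indicator, Set.mem_preimage, Pi.one_apply, QuotientAddGroup.mk_add]
  rfl

/-- **`ℬ₂` on `LWE_{k,m,q,γ}` gives `H₃`.** [cite: BrakerskiEtAl2013, Lemma 4.9 (proof, Eq. (h3))] -/
theorem b2Outputs_lweInputsUnif (m : ℕ) (t γ : ℝ) : b2Outputs (n := n) m t (lweInputsUnif k q m γ) = H3 k n q m t γ := by
  rw [b2Outputs, H3]
  congr 1
  funext C
  rw [lweInputsUnif, sum_smul_bind _ _ (measurable_piKernel (measurable_b2Kernel t C) m)]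
  congr 2
  funext s
  rw [pi_bind_piKernel (measurable_b2Kernel t C)]
  simp_rw [torusLWESample_bind_b2Kernel t γ s C]

end B2

/-! ### Expectations against `bind` and `map` of PMFs -/

section PMFSums

variable {X Y : Type*}

/-- `E_{y ← p.bind f} G = E_{x ← p} E_{y ← f x} G`. [folklore] -/
theorem tsum_bind_mul (p : PMF X) (f : X → PMF Y) (G : Y → ℝ≥0∞) :
    ∑' y, (p.bind f) y * G y = ∑' x, p x * ∑' y, f x y * G y := by
  calc ∑' y, (p.bind f) y * G y = ∑' y, ∑' x, p x * (f x y * G y) := by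
        refine tsum_congr fun y => ?_
        rw [PMF.bind_apply, ← ENNReal.tsum_mul_right]
        exact tsum_congr fun x => by rw [mul_assoc]
    _ = ∑' x, ∑' y, p x * (f x y * G y) := ENNReal.tsum_comm
    _ = ∑' x, p x * ∑' y, f x y * G y := tsum_congr fun x => ENNReal.tsum_mul_left

/-- `E_{y ← χ.map φ} G = E_{x ← χ} G(φ x)`. [folklore] -/
theorem tsum_map_mul [DecidableEq Y] (χ : PMF X) (φ : X → Y) (G : Y → ℝ≥0∞) :
    ∑' y, (χ.map φ) y * G y = ∑' x, χ x * G (φ x) := by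
  rw [PMF.map, tsum_bind_mul]
  refine tsum_congr fun x => ?_
  congr 1
  rw [tsum_eq_single (φ x) fun y hy => by rw [Function.comp_apply, PMF.pure_apply, if_neg hy, zero_mul]]
  simp

end PMFSums

/-! ### The transformation `ℬ₃`: forget the hints, refresh the second components -/

section B3

variable (k n q : ℕ) [NeZero q]

/-- **The position kernel of `ℬ₃`**: `(d, y) ↦ (d, u)` with a fresh `u ← Haar`. [cite: BrakerskiEtAl2013, Lemma 4.9 (proof, `ℬ₃`: "`H₄, H₅` … from `(C, Â)` and `(C, A)`")] -/
def b3Kernel (x : (Fin n → ZMod q) × ℤ) : Measure ((Fin n → ZMod q) × UnitAddCircle) :=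
  (volume : Measure UnitAddCircle).map (Prod.mk x.1)

variable {k n q}

omit [NeZero q] in
/-- The position kernel on a measurable set. [folklore] -/
theorem b3Kernel_apply (x : (Fin n → ZMod q) × ℤ) {S : Set ((Fin n → ZMod q) × UnitAddCircle)} (hS : MeasurableSet S) :
    b3Kernel n q x S = volume (Prod.mk x.1 ⁻¹' S) := by
  rw [b3Kernel, Measure.map_apply measurable_prodMk_left hS]

omit [NeZero q] in
/-- The position kernel is Markov (Haar measure on `𝕋` has mass one). [folklore] -/
instance isProbabilityMeasure_b3Kernel (x : (Fin n → ZMod q) × ℤ) : IsProbabilityMeasure (b3Kernel n q x) := by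
  constructor
  rw [b3Kernel_apply _ MeasurableSet.univ, Set.preimage_univ, UnitAddCircle.measure_univ]

/-- The position kernel is measurable (it factors through the countable first component). [folklore] -/
theorem measurable_b3Kernel : Measurable (b3Kernel n q) := by
  refine Measure.measurable_of_measurable_coe _ fun S hS => ?_
  simp_rw [b3Kernel_apply _ hS]
  exact measurable_from_prod_countable_right fun d => by dsimp only; exact measurable_const

/-- **The outputs of `ℬ₃`** on a transcript law `L` of `extLWE^m_{k,n,q,χ,·}`: forget `C̄` and the hints, refresh
every second component (a countable mixture over the transcripts of product kernels).
[cite: BrakerskiEtAl2013, Lemma 4.9 (proof, `ℬ₃`)] -/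
def b3Outputs (m : ℕ) (L : PMF (Matrix (Fin k) (Fin n) (ZMod q) × (Fin m → (Fin n → ZMod q) × ℤ))) :
    Measure (Fin m → (Fin n → ZMod q) × UnitAddCircle) :=
  Measure.sum fun T => L T • piKernel (b3Kernel n q) m T.2

/-- The one-position output law of `ℬ₃` on a one-position PMF. [folklore] -/
def b3One (P : PMF ((Fin n → ZMod q) × ℤ)) : Measure ((Fin n → ZMod q) × UnitAddCircle) :=
  Measure.sum fun x => P x • b3Kernel n q x

/-- **`ℬ₃` on one position of the first case gives one position of `H₄`.** [cite: BrakerskiEtAl2013, Lemma 4.9 (proof, Eq. (h4))] -/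
theorem b3One_extLWESecretSample (t : ℝ) (C : Matrix (Fin k) (Fin n) (ZMod q)) (z : Fin n → ℤ) :
    b3One (LWE.extLWESecretSample (noiseCol n t) C z) = h4Coord k n q t C := by
  have hF : Measurable fun p : (Fin k → ZMod q) × ((Fin n → ℤ) × UnitAddCircle) => (Cᵀ.mulVec p.1 + fun i => (p.2.1 i : ZMod q), p.2.2) :=
    measurable_from_prod_countable_right fun b => measurable_from_prod_countable_right fun N => by
      dsimp only; exact measurable_const.prodMk measurable_id
  ext S hS
  rw [b3One, Measure.sum_apply _ hS, h4Coord, Measure.map_apply hF hS, Measure.prod_apply (hF hS), lintegral_fintype]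
  simp_rw [Measure.smul_apply, smul_eq_mul, b3Kernel_apply _ hS, PMF.toMeasure_apply_singleton _ _ (measurableSet_singleton _),
    Measure.prod_apply (measurable_prodMk_left (hF hS))]
  conv_rhs => arg 2; ext b; rw [lintegral_countable']
  simp_rw [PMF.toMeasure_apply_singleton _ _ (measurableSet_singleton _)]
  classical
  rw [LWE.extLWESecretSample, tsum_bind_mul, tsum_fintype (L := SummationFilter.unconditional _)]
  refine Finset.sum_congr rfl fun b _ => ?_
  rw [mul_comm, tsum_map_mul]
  congr 1
  refine tsum_congr fun N => ?_
  rw [mul_comm]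
  rfl

/-- **`ℬ₃` on one position of the second case gives a uniform sample.** [cite: BrakerskiEtAl2013, Lemma 4.9 (proof, Eq. (h4))] -/
theorem b3One_extLWEUniformSample (t : ℝ) (z : Fin n → ℤ) : b3One (LWE.extLWEUniformSample (R := ZMod q) (noiseCol n t) z) = uniformInput n q := by
  classical
  ext S hS
  rw [b3One, Measure.sum_apply _ hS, uniformInput, Measure.prod_apply hS, lintegral_fintype]
  simp_rw [Measure.smul_apply, smul_eq_mul, b3Kernel_apply _ hS, PMF.toMeasure_apply_singleton _ _ (measurableSet_singleton _)]
  rw [LWE.extLWEUniformSample, tsum_bind_mul, tsum_fintype (L := SummationFilter.unconditional _)]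
  refine Finset.sum_congr rfl fun b _ => ?_
  rw [mul_comm, tsum_map_mul]
  congr 1
  simp only
  rw [ENNReal.tsum_mul_right, PMF.tsum_coe, one_mul]

/-- A bind against a point-mass measure is the countable mixture. [folklore] -/
theorem toMeasure_bind_eq_sum {X Y : Type*} [MeasurableSpace X] [MeasurableSingletonClass X] [Countable X] [MeasurableSpace Y]
    (p : PMF X) {f : X → Measure Y} (hf : Measurable f) : p.toMeasure.bind f = Measure.sum fun x => p x • f x := by
  ext S hS
  rw [Measure.bind_apply hS hf.aemeasurable, lintegral_countable', Measure.sum_apply _ hS]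
  refine tsum_congr fun x => ?_
  rw [PMF.toMeasure_apply_singleton _ _ (measurableSet_singleton _), Measure.smul_apply, smul_eq_mul, mul_comm]

/-- `b3One P` is the bind of `P` with the position kernel. [folklore] -/
theorem b3One_eq_bind (P : PMF ((Fin n → ZMod q) × ℤ)) : b3One P = P.toMeasure.bind (b3Kernel n q) :=
  (toMeasure_bind_eq_sum P measurable_b3Kernel).symm

/-- A sum of measures over a product index is an iterated sum. [folklore] -/
theorem sum_prod_index {A B Y : Type*} [MeasurableSpace Y] (f : A × B → Measure Y) :
    Measure.sum f = Measure.sum fun a => Measure.sum fun b => f (a, b) := by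
  ext S hS
  rw [Measure.sum_apply _ hS, Measure.sum_apply _ hS, ENNReal.tsum_prod']
  exact tsum_congr fun a => (Measure.sum_apply _ hS).symm

/-- The outputs of `ℬ₃` on a transcript law of the form "`C̄` uniform, then `m` independent positions". [folklore] -/
theorem b3Outputs_bind_indepLaw (m : ℕ) (P : Matrix (Fin k) (Fin n) (ZMod q) → PMF ((Fin n → ZMod q) × ℤ)) :
    b3Outputs (k := k) m ((PMF.uniformOfFintype (Matrix (Fin k) (Fin n) (ZMod q))).bind fun C => (indepLaw m fun _ => P C).map fun w => (C, w)) =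
      Measure.sum fun C : Matrix (Fin k) (Fin n) (ZMod q) => (PMF.uniformOfFintype _ C) • Measure.pi fun _ : Fin m => b3One (P C) := by
  classical
  rw [b3Outputs, sum_prod_index]
  congr 1
  funext C
  -- the transcript law at `(C, w)` is `U(C) · (⨂ P C)(w)`
  have hL : ∀ w, ((PMF.uniformOfFintype (Matrix (Fin k) (Fin n) (ZMod q))).bind fun C' => (indepLaw m fun _ => P C').map fun w => (C', w)) (C, w) =
      PMF.uniformOfFintype _ C * indepLaw m (fun _ => P C) w := by
    intro w
    rw [PMF.bind_apply, tsum_eq_single C]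
    · congr 1
      rw [PMF.map_apply, tsum_eq_single w]
      · simp
      · intro w' hw'; rw [if_neg (by simpa using Ne.symm hw')]
    · intro C' hC'
      rw [PMF.map_apply, ENNReal.tsum_eq_zero.2 fun w' => by rw [if_neg (fun h => hC' (Prod.mk.inj h).1.symm)], mul_zero]
  simp_rw [hL, mul_smul]
  have hsum : (Measure.sum fun w => (PMF.uniformOfFintype (Matrix (Fin k) (Fin n) (ZMod q))) C • ((indepLaw m fun _ => P C) w • piKernel (b3Kernel n q) m w)) =
      (PMF.uniformOfFintype _ C) • Measure.sum fun w => (indepLaw m fun _ => P C) w • piKernel (b3Kernel n q) m w := by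
    ext S hS
    simp only [Measure.sum_apply _ hS, Measure.smul_apply, smul_eq_mul, ENNReal.tsum_mul_left]
  rw [hsum]
  congr 1
  rw [show (Measure.sum fun w => (indepLaw m fun _ => P C) w • piKernel (b3Kernel n q) m w) =
      (indepLaw m fun _ => P C).toMeasure.bind (piKernel (b3Kernel n q) m) from
    (toMeasure_bind_eq_sum _ (measurable_piKernel measurable_b3Kernel m)).symm,
    toMeasure_indepLaw, pi_bind_piKernel measurable_b3Kernel]
  simp_rw [b3One_eq_bind]

/-- **`ℬ₃` on `extLWE^m` (first case) gives `H₄`.** [cite: BrakerskiEtAl2013, Lemma 4.9 (proof, Eq. (h4))] -/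
theorem b3Outputs_extLWEReal (m : ℕ) (t : ℝ) (z : Fin n → ℤ) :
    b3Outputs (k := k) m (LWE.extLWEReal (noiseCol n t) m z) = H4 k n q m t := by
  rw [LWE.extLWEReal, b3Outputs_bind_indepLaw, H4]
  simp_rw [b3One_extLWESecretSample]

/-- **`ℬ₃` on `extLWE^m` (second case) gives `H₅ = P₀`.** [cite: BrakerskiEtAl2013, Lemma 4.9 (proof, Eq. (h4))] -/
theorem b3Outputs_extLWEIdeal (m : ℕ) (t : ℝ) (z : Fin n → ℤ) :
    b3Outputs (k := k) m (LWE.extLWEIdeal k (noiseCol n t) m z) = H5 n q m := by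
  rw [LWE.extLWEIdeal, b3Outputs_bind_indepLaw, H5, uniformInputs]
  simp_rw [b3One_extLWEUniformSample]
  -- a mixture of a constant family is the constant
  ext S hS
  rw [Measure.sum_apply _ hS]
  simp_rw [Measure.smul_apply, smul_eq_mul]
  rw [ENNReal.tsum_mul_right, PMF.tsum_coe, one_mul]

end B3


end BLPRS2013

end Literature.Computability.Cryptography

end
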